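import Mathlib
import HarnessLib

/-!
# Finite chain rings are generated additively by `r·s` elements (McDonald, *Finite Rings with
# Identity*, Ch. XVII, Lemma XVII.4)

A CHAIN RING is a local principal ideal ring `R`: maximal ideal `m = Rθ`, characteristic `p^n`,
`k = R/m` with `|k| = p^r`, RAMIFICATION INDEX `s`, `(p) = m^s` (McDonald 1974, Ch. XVII, set-up
before Lemma XVII.4; invariants `p, n, r, s, t` after Thm XVII.5). Lemma XVII.4 prints: "(a)
`R = T ⊕ Tθ ⊕ ⋯ ⊕ Tθ^{s-1}` (as a `T`-module)", `T = GR(p^n, r)` the coefficient Galois ring,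
proved from "`R = T + Tθ + ⋯ + Tθ^{β-1} + Rp = T + ⋯ + Tθ^{β-1}` by Nakayama's Lemma". Since
`GR(p^n, r)` is generated by `r` elements over `ℤ/p^n`, (a) says in particular that `R` is
generated AS AN ADDITIVE GROUP by `r·s` elements. [cite: McDonald1974FiniteRings, Lemma XVII.4]

This file proves that COROLLARY directly by the printed Nakayama step, without constructing `T`:
`addSubgroup_closure_mul_pow_eq_top` (any commutative `R` with `(p : R)^n = 0`, `θ : R`, a family
`b` whose residues generate `R/(θ)` additively, `θ^s ∈ (p)` ⇒ the `b_j θ^i`, `i < s`, generate `R`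
additively) and `exists_additive_generators_of_card_residueField` (local `R`, maximal ideal
`(θ)`, `p` prime, `|R/(θ)| = p^r`, `θ^s ∈ (p)` ⇒ generators indexed by `Fin r × Fin s`).
Typed vs printed: WEAKER than XVII.4 (a) (generation, not a direct-sum decomposition over `T`)
under MORE GENERAL hypotheses (no finiteness; `θ^s ∈ (p)` for any `s`, equality for the
ramification index). Consumer: `Summit.ValiantsHypothesis.ValiantsHypothesis.Theorems.
TwoAdicLadderPrecisionLadder.stub_descent_of_boundedGenerators` (p578747) — its hypotheses
`(s : Fin d → S) (hs : AddSubgroup.closure (Set.range s) = ⊤) (hd : d ≤ n ^ a)` are discharged by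
`exists_additive_generators_fin_mul` below with `d = r·s` = (residue degree)·(ramification
index), i.e. "`e·f ≤ n^a`" in that stub's language. Theorems only; no definition, no named fact.
-/

namespace Literature.RingTheory.CompleteLocalRings

/-- **Generator count behind McDonald's Lemma XVII.4 (a)**, general form: if `(p : R)^n = 0`,
the residues of `b : ι → R` generate `R ⧸ (θ)` as an additive group, and `θ^s ∈ (p)`, then the
products `b j * θ ^ i` (`i < s`) generate `R` as an additive group (printed: "`R = T + Tθ + ⋯ +
Tθ^{β-1} + Rp = T + ⋯ + Tθ^{β-1}` by Nakayama").
[cite: McDonald1974FiniteRings, Lemma XVII.4 (a) and proof] -/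
theorem addSubgroup_closure_mul_pow_eq_top {R : Type*} [CommRing R] {p n : ℕ}
    (hpn : (p : R) ^ n = 0) (θ : R) {ι : Type*} (b : ι → R)
    (hb : ∀ x : R, ∃ a ∈ AddSubgroup.closure (Set.range b), x - a ∈ Ideal.span {θ})
    {s : ℕ} (hs : θ ^ s ∈ Ideal.span {(p : R)}) :
    AddSubgroup.closure (Set.range fun ji : ι × Fin s => b ji.1 * θ ^ (ji.2 : ℕ)) = ⊤ := by
  set A := AddSubgroup.closure (Set.range fun ji : ι × Fin s => b ji.1 * θ ^ (ji.2 : ℕ))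
  -- `(closure of the b's) · θ^i ⊆ A` for `i < s`
  have hmem : ∀ i < s, ∀ a ∈ AddSubgroup.closure (Set.range b), a * θ ^ i ∈ A := by
    intro i hi a ha
    induction ha using AddSubgroup.closure_induction with
    | mem x hx =>
      obtain ⟨j, rfl⟩ := hx
      exact AddSubgroup.subset_closure ⟨(j, ⟨i, hi⟩), rfl⟩
    | zero => rw [zero_mul]; exact A.zero_mem
    | add x y _ _ hx hy => rw [add_mul]; exact A.add_mem hx hy
    | neg x _ hx => rw [neg_mul]; exact A.neg_mem hx
  -- `x ∈ A + θ^i R` for `i ≤ s`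
  have step : ∀ i ≤ s, ∀ x : R, ∃ a ∈ A, ∃ y : R, x = a + θ ^ i * y := by
    intro i
    induction i with
    | zero => intro _ x; exact ⟨0, A.zero_mem, x, by simp⟩
    | succ i ih =>
      intro hi x
      obtain ⟨a, ha, y, rfl⟩ := ih (Nat.le_of_succ_le hi) x
      obtain ⟨a₀, ha₀, hy⟩ := hb y
      obtain ⟨z, hz⟩ := Ideal.mem_span_singleton'.1 hy
      refine ⟨a + a₀ * θ ^ i, A.add_mem ha (hmem i (Nat.lt_of_succ_le hi) a₀ ha₀), z, ?_⟩
      have hy' : y = a₀ + z * θ := by rw [hz]; ring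
      rw [hy']; ring
  -- `x ∈ A + p^j R` for every `j`
  have hpj : ∀ j : ℕ, ∀ x : R, ∃ a ∈ A, ∃ y : R, x = a + (p : R) ^ j * y := by
    intro j
    induction j with
    | zero => intro x; exact ⟨0, A.zero_mem, x, by simp⟩
    | succ j ih =>
      intro x
      obtain ⟨a, ha, y, rfl⟩ := ih x
      obtain ⟨a', ha', y', rfl⟩ := step s le_rfl y
      obtain ⟨z, hz⟩ := Ideal.mem_span_singleton'.1 hs
      refine ⟨a + (p : R) ^ j * a', A.add_mem ha ?_, z * y', by rw [← hz]; ring⟩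
      have h : (p : R) ^ j * a' = (p ^ j : ℕ) • a' := by rw [nsmul_eq_mul, Nat.cast_pow]
      rw [h]
      exact A.nsmul_mem ha' _
  rw [eq_top_iff]
  rintro x -
  obtain ⟨a, ha, y, rfl⟩ := hpj n x
  rw [hpn, zero_mul, add_zero]
  exact ha

/-- A finite field of characteristic `p` and cardinality `p^r` is generated as an additive group
by `r` elements (an `𝔽_p`-basis). [folklore] -/
private theorem exists_additive_generators_of_card_eq {k : Type*} [Field k] [Fintype k]
    {p r : ℕ} (hp : p.Prime) [CharP k p] (hcard : Fintype.card k = p ^ r) :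
    ∃ β : Fin r → k, AddSubgroup.closure (Set.range β) = ⊤ := by
  haveI : Fact p.Prime := ⟨hp⟩
  letI : Algebra (ZMod p) k := ZMod.algebra k p
  have hfin : Module.finrank (ZMod p) k = r := by
    have h : Fintype.card k = p ^ Module.finrank (ZMod p) k := by
      rw [Module.card_eq_pow_finrank (K := ZMod p) (V := k), ZMod.card]
    rw [hcard] at h
    exact (Nat.pow_right_injective hp.two_le h).symm
  let β := Module.finBasisOfFinrankEq (ZMod p) k hfin
  refine ⟨β, ?_⟩
  rw [eq_top_iff]
  rintro x -
  have hxmem : x ∈ Submodule.span (ZMod p) (Set.range β) := by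
    rw [β.span_eq]; exact Submodule.mem_top
  obtain ⟨c, hc⟩ := (Submodule.mem_span_range_iff_exists_fun (R := ZMod p)).1 hxmem
  rw [← hc]
  refine AddSubgroup.sum_mem _ fun i _ => ?_
  rw [← ZMod.natCast_zmod_val (c i), Nat.cast_smul_eq_nsmul]
  exact AddSubgroup.nsmul_mem _ (AddSubgroup.subset_closure (Set.mem_range_self i)) _

/-- **A chain ring of residue degree `r` and ramification `s` is generated additively by `r·s`
elements** (corollary of McDonald's Lemma XVII.4 (a): `R = T ⊕ Tθ ⊕ ⋯ ⊕ Tθ^{s-1}`,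
`T = GR(p^n, r)`): if `R` is local with principal maximal ideal `(θ)`, `(p : R)^n = 0` with `p`
prime, the residue field has `p^r` elements, and `θ^s ∈ (p)` (equality `(p) = (θ)^s` defines the
ramification index), then some family indexed by `Fin r × Fin s` generates `R` as an additive
group. [cite: McDonald1974FiniteRings, Lemma XVII.4 (a)] -/
theorem exists_additive_generators_of_card_residueField {R : Type*} [CommRing R] [IsLocalRing R]
    {p n r s : ℕ} (hp : p.Prime) (hpn : (p : R) ^ n = 0) (θ : R)
    (hθ : IsLocalRing.maximalIdeal R = Ideal.span {θ})
    (hcard : Nat.card (IsLocalRing.ResidueField R) = p ^ r)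
    (hs : θ ^ s ∈ Ideal.span {(p : R)}) :
    ∃ g : Fin r × Fin s → R, AddSubgroup.closure (Set.range g) = ⊤ := by
  -- the residue field is finite of characteristic `p`
  haveI : Finite (IsLocalRing.ResidueField R) :=
    Nat.finite_of_card_ne_zero (by rw [hcard]; exact pow_ne_zero _ hp.ne_zero)
  letI : Fintype (IsLocalRing.ResidueField R) := Fintype.ofFinite _
  have hcard' : Fintype.card (IsLocalRing.ResidueField R) = p ^ r := by
    rw [← Nat.card_eq_fintype_card, hcard]
  have hp0 : (p : IsLocalRing.ResidueField R) = 0 := by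
    rcases Nat.eq_zero_or_pos n with hn | hn
    · subst hn
      rw [pow_zero] at hpn
      exact absurd hpn one_ne_zero
    · have h : (p : IsLocalRing.ResidueField R) ^ n = 0 := by
        rw [← map_natCast (IsLocalRing.residue R), ← map_pow, hpn, map_zero]
      exact (pow_eq_zero_iff hn.ne').1 h
  haveI : CharP (IsLocalRing.ResidueField R) p := (CharP.charP_iff_prime_eq_zero hp).2 hp0
  obtain ⟨β, hβ⟩ := exists_additive_generators_of_card_eq hp hcard'
  choose b hb using fun j => Ideal.Quotient.mk_surjective (I := IsLocalRing.maximalIdeal R) (β j)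
  refine ⟨fun ji => b ji.1 * θ ^ (ji.2 : ℕ), addSubgroup_closure_mul_pow_eq_top hpn θ b ?_ hs⟩
  intro x
  have hx : IsLocalRing.residue R x ∈ (AddSubgroup.closure (Set.range b)).map
      (IsLocalRing.residue R).toAddMonoidHom := by
    rw [AddMonoidHom.map_closure, ← Set.range_comp]
    have hcomp : ((IsLocalRing.residue R).toAddMonoidHom ∘ b) = β := funext fun j => hb j
    rw [hcomp, hβ]
    exact AddSubgroup.mem_top _
  obtain ⟨a, ha, hax⟩ := AddSubgroup.mem_map.1 hx
  refine ⟨a, ha, ?_⟩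
  rw [← hθ, ← Ideal.Quotient.eq]
  exact hax.symm

/-- The same with a family indexed by `Fin (r * s)` (the shape `s : Fin d → S`, `d = r·s`, of
the consumer `stub_descent_of_boundedGenerators`).
[cite: McDonald1974FiniteRings, Lemma XVII.4 (a)] -/
theorem exists_additive_generators_fin_mul {R : Type*} [CommRing R] [IsLocalRing R]
    {p n r s : ℕ} (hp : p.Prime) (hpn : (p : R) ^ n = 0) (θ : R)
    (hθ : IsLocalRing.maximalIdeal R = Ideal.span {θ})
    (hcard : Nat.card (IsLocalRing.ResidueField R) = p ^ r)
    (hs : θ ^ s ∈ Ideal.span {(p : R)}) :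
    ∃ g : Fin (r * s) → R, AddSubgroup.closure (Set.range g) = ⊤ := by
  obtain ⟨g, hg⟩ := exists_additive_generators_of_card_residueField hp hpn θ hθ hcard hs
  refine ⟨g ∘ finProdFinEquiv.symm, ?_⟩
  rw [Set.range_comp, finProdFinEquiv.symm.surjective.range_eq, Set.image_univ, hg]

end Literature.RingTheory.CompleteLocalRings
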